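import Literature.Analysis.FunctionSpaces.ContDiffHolderInterpolation
import Literature.Analysis.FunctionSpaces.ContDiffHolderDiffOperator
import Literature.Analysis.FunctionSpaces.SchauderLocalVariable
import HarnessLib

/-!
# The `C^{2,r}` norm from frame entries, and `ε`-interpolation of the `C^{1,r}` data (Schauder program, C1)

Topic `Literature/Analysis/FunctionSpaces`. Bookkeeping between the bundled norm of
`C^{2,r}_b(E, F)` (`ContDiffHolderFunction`, part 3) and the frame quantities the Schauder
estimates of parts B3/C2 produce and consume (Gilbarg–Trudinger 2001, §6.8, (6.82)–(6.86)):

* `holderWith_iteratedFDeriv_two_of_entries` — `[D²u]_r ≤ n² max_{pq} [D²u(e_p,e_q)]_r`;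
* `exists_norm_le_of_entries` — `‖v‖_{2,r} ≤ C (sup|v| + max_{pq} [D²v(e_p,e_q)]_r)`;
* `exists_lowerOrder_le` — for `0 < ε ≤ 1`: `sup‖Dv‖, sup‖D²v‖, ‖v‖_{1,r} ≤ ε‖v‖_{2,r} + C_ε sup|v|`.

Census item (2a) of `Literature.Geometry.Riemannian.gurskyViaclovsky_pathOpen_weighted_four`.
Everything is proved; no named facts.

## References

* D. Gilbarg, N. S. Trudinger, *Elliptic Partial Differential Equations of Second Order* (2001),
  §6.8, (6.82)–(6.86). [GilbargTrudinger2001]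
-/

noncomputable section

open Filter Topology Function Metric Set
open scoped NNReal ContDiff InnerProductSpace RealInnerProductSpace

namespace Literature.Analysis.FunctionSpaces

section Entries

variable {ι : Type*} [Fintype ι] {E : Type*} [NormedAddCommGroup E]
  [InnerProductSpace ℝ E] {F : Type*} [NormedAddCommGroup F] [NormedSpace ℝ F]

/-- **The operator Hölder seminorm of `D²u` from its frame entries**:
`[D²u]_r ≤ n² H` if every entry `x ↦ D²u(x)(e_p, e_q)` is `r`-Hölder with constant `H`. [folklore] -/
theorem holderWith_iteratedFDeriv_two_of_entries (bE : OrthonormalBasis ι ℝ E) (u : E → F)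
    {H r : ℝ≥0} (h : ∀ i j, HolderWith H r (fun x => iteratedFDeriv ℝ 2 u x ![bE i, bE j])) :
    HolderWith ((Fintype.card ι : ℝ≥0) ^ 2 * H) r (iteratedFDeriv ℝ 2 u) := by
  refine holderWith_of_dist_le fun x y => ?_
  rw [dist_eq_norm]
  have hd : 0 ≤ (H : ℝ) * dist x y ^ (r : ℝ) := by positivity
  refine ContinuousMultilinearMap.opNorm_le_bound (by positivity) fun m => ?_
  have hm : (iteratedFDeriv ℝ 2 u x - iteratedFDeriv ℝ 2 u y) m =
      iteratedFDeriv ℝ 2 u x ![m 0, m 1] - iteratedFDeriv ℝ 2 u y ![m 0, m 1] := by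
    have : m = ![m 0, m 1] := by funext i; fin_cases i <;> rfl
    rw [sub_apply, ← this]
  rw [hm, iteratedFDeriv_two_eq_sum_orthonormalBasis bE u x (m 0) (m 1),
    iteratedFDeriv_two_eq_sum_orthonormalBasis bE u y (m 0) (m 1), ← Finset.sum_sub_distrib,
    Fin.prod_univ_two]
  simp only [← Finset.sum_sub_distrib, ← smul_sub]
  calc ‖∑ i, ∑ j, (⟪bE i, m 0⟫ * ⟪bE j, m 1⟫) •
        (iteratedFDeriv ℝ 2 u x ![bE i, bE j] - iteratedFDeriv ℝ 2 u y ![bE i, bE j])‖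
      ≤ ∑ i, ∑ j, ‖(⟪bE i, m 0⟫ * ⟪bE j, m 1⟫) •
        (iteratedFDeriv ℝ 2 u x ![bE i, bE j] - iteratedFDeriv ℝ 2 u y ![bE i, bE j])‖ :=
        (norm_sum_le _ _).trans (Finset.sum_le_sum fun i _ => norm_sum_le _ _)
    _ ≤ ∑ _i : ι, ∑ _j : ι, ‖m 0‖ * ‖m 1‖ * (H * dist x y ^ (r : ℝ)) := by
        refine Finset.sum_le_sum fun i _ => Finset.sum_le_sum fun j _ => ?_
        rw [norm_smul, norm_mul, ← dist_eq_norm]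
        refine mul_le_mul (mul_le_mul ?_ ?_ (norm_nonneg _) (norm_nonneg _)) ((h i j).dist_le x y)
          dist_nonneg (by positivity)
        · exact (norm_inner_le_norm _ _).trans (by rw [bE.norm_eq_one, one_mul])
        · exact (norm_inner_le_norm _ _).trans (by rw [bE.norm_eq_one, one_mul])
    _ = ((Fintype.card ι : ℝ≥0) ^ 2 * H : ℝ≥0) * dist x y ^ (r : ℝ) * (‖m 0‖ * ‖m 1‖) := by
        simp only [Finset.sum_const, Finset.card_univ, nsmul_eq_mul]
        push_cast
        ring

/-- **The `C^{2,r}` norm from frame entries**: for `0 < r ≤ 1` there is `C` (depending on `r`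
and `n`) with `‖v‖_{2,r} ≤ C (A + H)` whenever `|v| ≤ A` and the frame entries of `D²v` are
`r`-Hölder with constant `H` (interpolation, Gilbarg–Trudinger (6.82)–(6.86)).
[cite: GilbargTrudinger2001, §6.8] -/
theorem exists_norm_le_of_entries (bE : OrthonormalBasis ι ℝ E) {r : ℝ≥0} (hr0 : 0 < r) :
    ∃ C : ℝ, 0 ≤ C ∧ ∀ (v : ContDiffHolderFunction E F 2 r) (H : ℝ≥0) (A : ℝ),
      (∀ i j, HolderWith H r (fun x => iteratedFDeriv ℝ 2 (v : E → F) x ![bE i, bE j])) →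
      (∀ x, ‖v x‖ ≤ A) → ‖v‖ ≤ C * (A + H) := by
  have hr0' : (0 : ℝ) < r := hr0
  -- the interpolation parameter `δ`: `δ ≤ 1/8`, `δ^r ≤ 1/8`
  set δ : ℝ := min (1 / 8) ((1 / 8 : ℝ) ^ (1 / (r : ℝ))) with hδ
  have hδ0 : 0 < δ := lt_min (by norm_num) (Real.rpow_pos_of_pos (by norm_num) _)
  have hδ1 : δ ≤ 1 / 8 := min_le_left _ _
  have hδr : δ ^ (r : ℝ) ≤ 1 / 8 := by
    calc δ ^ (r : ℝ) ≤ ((1 / 8 : ℝ) ^ (1 / (r : ℝ))) ^ (r : ℝ) :=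
          Real.rpow_le_rpow hδ0.le (min_le_right _ _) hr0'.le
      _ = 1 / 8 := by
          rw [← Real.rpow_mul (by norm_num), one_div_mul_cancel hr0'.ne', Real.rpow_one]
  set n : ℝ := (Fintype.card ι : ℝ) with hn
  refine ⟨2 * (1 + 2 / δ ^ 2 + 4 / δ ^ 3) + 2 * n ^ 2, by positivity, fun v H A hH hA => ?_⟩
  have hA0 : 0 ≤ A := (norm_nonneg _).trans (hA 0)
  -- the four pieces of the norm
  have h0 : v.supNormDeriv 0 ≤ A :=
    v.supNormDeriv_le 0 hA0 fun x => by rw [norm_iteratedFDeriv_zero]; exact hA x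
  have h1x : ∀ x, ‖iteratedFDeriv ℝ 1 (v : E → F) x‖ ≤ 2 * A / δ ^ 2 + ‖v‖ * δ ^ 2 :=
    v.norm_iteratedFDeriv_one_le_interpolate (by positivity) hA
  have h1 : v.supNormDeriv 1 ≤ 2 * A / δ ^ 2 + ‖v‖ * δ ^ 2 :=
    v.supNormDeriv_le 1 (by positivity) h1x
  have h2x : ∀ x, ‖iteratedFDeriv ℝ 2 (v : E → F) x‖ ≤
      2 * (2 * A / δ ^ 2 + ‖v‖ * δ ^ 2) / δ + ‖v‖ * δ ^ (r : ℝ) :=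
    v.norm_iteratedFDeriv_top_le_interpolate (m := 1) hδ0 h1x
  have h2 : v.supNormDeriv 2 ≤ 2 * (2 * A / δ ^ 2 + ‖v‖ * δ ^ 2) / δ + ‖v‖ * δ ^ (r : ℝ) :=
    v.supNormDeriv_le 2 (by positivity) h2x
  have h3 : (nnHolderNorm r (iteratedFDeriv ℝ 2 (v : E → F)) : ℝ) ≤ n ^ 2 * H := by
    have := (holderWith_iteratedFDeriv_two_of_entries bE (v : E → F) hH).nnholderNorm_le
    rw [hn]
    exact_mod_cast this
  have hnorm : ‖v‖ = v.supNormDeriv 0 + v.supNormDeriv 1 + v.supNormDeriv 2 +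
      nnHolderNorm r (iteratedFDeriv ℝ 2 (v : E → F)) := by
    rw [v.norm_def, Finset.sum_range_succ, Finset.sum_range_succ, Finset.sum_range_one]
  -- absorb
  have hv0 : 0 ≤ ‖v‖ := norm_nonneg _
  have hsmall : δ ^ 2 + 2 * δ + δ ^ (r : ℝ) ≤ 1 / 2 := by nlinarith
  have hkey : ‖v‖ ≤ A * (1 + 2 / δ ^ 2 + 4 / δ ^ 3) + n ^ 2 * H +
      ‖v‖ * (δ ^ 2 + 2 * δ + δ ^ (r : ℝ)) := by
    have e : 2 * (2 * A / δ ^ 2 + ‖v‖ * δ ^ 2) / δ = 4 * A / δ ^ 3 + 2 * ‖v‖ * δ := by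
      field_simp
      ring
    rw [e] at h2
    have := add_le_add (add_le_add (add_le_add h0 h1) h2) h3
    rw [← hnorm] at this
    have e2 : A + (2 * A / δ ^ 2 + ‖v‖ * δ ^ 2) + (4 * A / δ ^ 3 + 2 * ‖v‖ * δ + ‖v‖ * δ ^ (r : ℝ)) +
        n ^ 2 * H = A * (1 + 2 / δ ^ 2 + 4 / δ ^ 3) + n ^ 2 * H +
        ‖v‖ * (δ ^ 2 + 2 * δ + δ ^ (r : ℝ)) := by ring
    linarith
  have hhalf : ‖v‖ * (δ ^ 2 + 2 * δ + δ ^ (r : ℝ)) ≤ ‖v‖ * (1 / 2) :=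
    mul_le_mul_of_nonneg_left hsmall hv0
  have hH0 : (0 : ℝ) ≤ H := NNReal.coe_nonneg _
  have h2X : ‖v‖ ≤ 2 * (A * (1 + 2 / δ ^ 2 + 4 / δ ^ 3) + n ^ 2 * H) := by linarith
  have hextra : 0 ≤ A * n ^ 2 + H * (1 + 2 / δ ^ 2 + 4 / δ ^ 3) := by positivity
  have e : (2 * (1 + 2 / δ ^ 2 + 4 / δ ^ 3) + 2 * n ^ 2) * (A + H) =
      2 * (A * (1 + 2 / δ ^ 2 + 4 / δ ^ 3) + n ^ 2 * H) +
        2 * (A * n ^ 2 + H * (1 + 2 / δ ^ 2 + 4 / δ ^ 3)) := by ring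
  linarith

/-- **`ε`-interpolation of the lower-order data** of a member of `C^{2,r}_b`: for `0 < ε`
there is `C_ε` with `sup‖Dv‖ ≤ ε‖v‖ + C_ε A`, `sup‖D²v‖ ≤ ε‖v‖ + C_ε A` and
`‖v‖_{1,r} ≤ ε‖v‖ + C_ε A` whenever `|v| ≤ A` (Gilbarg–Trudinger (6.82)–(6.86)).
[cite: GilbargTrudinger2001, §6.8] -/
theorem exists_lowerOrder_le [CompleteSpace F] {r : ℝ≥0} (hr0 : 0 < r) (hr1 : r ≤ 1) {ε : ℝ}
    (hε : 0 < ε) :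
    ∃ C : ℝ, 0 ≤ C ∧ ∀ (v : ContDiffHolderFunction E F 2 r) (A : ℝ), (∀ x, ‖v x‖ ≤ A) →
      (∀ x, ‖fderiv ℝ (v : E → F) x‖ ≤ ε * ‖v‖ + C * A) ∧
      (∀ x, ‖iteratedFDeriv ℝ 2 (v : E → F) x‖ ≤ ε * ‖v‖ + C * A) ∧
      ‖ContDiffHolderFunction.inclCLM hr1 v‖ ≤ ε * ‖v‖ + C * A := by
  have hr0' : (0 : ℝ) < r := hr0
  -- parameters: `ε' = ε/4`, `h^r = ε'/2`, `h' = ε' h/4`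
  set ε' : ℝ := ε / 4 with hε'
  have hε'0 : 0 < ε' := by positivity
  set h : ℝ := (ε' / 2) ^ (1 / (r : ℝ)) with hh
  have hh0 : 0 < h := Real.rpow_pos_of_pos (by positivity) _
  have hhr : h ^ (r : ℝ) = ε' / 2 := by
    rw [hh, ← Real.rpow_mul (by positivity), one_div_mul_cancel hr0'.ne', Real.rpow_one]
  set h' : ℝ := ε' * h / 4 with hh'
  have hh'0 : 0 < h' := by positivity
  -- the constant
  refine ⟨2 / ε' + 16 / (ε' * h ^ 2) + (1 + 3 * (2 / ε') + 16 / (ε' * h ^ 2)), by positivity,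
    fun v A hA => ?_⟩
  have hA0 : 0 ≤ A := (norm_nonneg _).trans (hA 0)
  have hv0 : 0 ≤ ‖v‖ := norm_nonneg _
  -- `sup ‖Dv‖ ≤ ε'‖v‖ + 2A/ε'`
  have hD1 : ∀ x, ‖fderiv ℝ (v : E → F) x‖ ≤ ε' * ‖v‖ + 2 / ε' * A := fun x => by
    have h1 := v.norm_iteratedFDeriv_one_le_interpolate hε'0 hA x
    rw [← norm_iteratedFDeriv_fderiv (n := 0), norm_iteratedFDeriv_zero] at h1
    calc ‖fderiv ℝ (v : E → F) x‖ ≤ 2 * A / ε' + ‖v‖ * ε' := h1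
      _ = ε' * ‖v‖ + 2 / ε' * A := by ring
  -- `sup ‖D²v‖ ≤ ε'‖v‖ + 16A/(ε' h²)`
  have hD1' : ∀ x, ‖iteratedFDeriv ℝ 1 (v : E → F) x‖ ≤ 2 * A / h' + ‖v‖ * h' :=
    v.norm_iteratedFDeriv_one_le_interpolate hh'0 hA
  have hD2 : ∀ x, ‖iteratedFDeriv ℝ 2 (v : E → F) x‖ ≤ ε' * ‖v‖ + 16 / (ε' * h ^ 2) * A := by
    intro x
    have h2 := v.norm_iteratedFDeriv_top_le_interpolate (m := 1) hh0 hD1' x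
    rw [hhr] at h2
    have e : 2 * (2 * A / h' + ‖v‖ * h') / h + ‖v‖ * (ε' / 2) =
        ε' * ‖v‖ + 16 / (ε' * h ^ 2) * A := by
      rw [hh']
      field_simp
      ring
    linarith
  have hD1sup : v.supNormDeriv 1 ≤ ε' * ‖v‖ + 2 / ε' * A :=
    v.supNormDeriv_le 1 (by positivity) fun x => by
      rw [← norm_iteratedFDeriv_fderiv (n := 0), norm_iteratedFDeriv_zero]; exact hD1 x
  refine ⟨fun x => (hD1 x).trans ?_, fun x => (hD2 x).trans ?_, ?_⟩
  · have : ε' * ‖v‖ ≤ ε * ‖v‖ := by rw [hε']; nlinarith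
    have : 2 / ε' * A ≤ (2 / ε' + 16 / (ε' * h ^ 2) + (1 + 3 * (2 / ε') + 16 / (ε' * h ^ 2))) * A :=
      mul_le_mul_of_nonneg_right (by
        have : (0:ℝ) ≤ 16 / (ε' * h ^ 2) := by positivity
        have : (0:ℝ) ≤ 1 + 3 * (2 / ε') + 16 / (ε' * h ^ 2) := by positivity
        linarith) hA0
    linarith
  · have : ε' * ‖v‖ ≤ ε * ‖v‖ := by rw [hε']; nlinarith
    have : 16 / (ε' * h ^ 2) * A ≤
        (2 / ε' + 16 / (ε' * h ^ 2) + (1 + 3 * (2 / ε') + 16 / (ε' * h ^ 2))) * A :=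
      mul_le_mul_of_nonneg_right (by
        have : (0:ℝ) ≤ 2 / ε' := by positivity
        have : (0:ℝ) ≤ 1 + 3 * (2 / ε') + 16 / (ε' * h ^ 2) := by positivity
        linarith) hA0
    linarith
  · -- the `C^{1,r}` norm: `A + sup‖Dv‖ + [Dv]_r`, `[Dv]_r ≤ sup‖D²v‖ + 2 sup‖Dv‖`
    set w := ContDiffHolderFunction.inclCLM hr1 v with hw
    have hwcoe : ((w : ContDiffHolderFunction E F 1 r) : E → F) = v :=
      ContDiffHolderFunction.coe_inclCLM hr1 v
    have hw0 : w.supNormDeriv 0 ≤ A :=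
      w.supNormDeriv_le 0 hA0 fun x => by rw [norm_iteratedFDeriv_zero, hwcoe]; exact hA x
    have hw1 : w.supNormDeriv 1 ≤ ε' * ‖v‖ + 2 / ε' * A :=
      w.supNormDeriv_le 1 (by positivity) fun x => by
        rw [hwcoe, ← norm_iteratedFDeriv_fderiv (n := 0), norm_iteratedFDeriv_zero]; exact hD1 x
    have hwH : (nnHolderNorm r (iteratedFDeriv ℝ 1 ((w : ContDiffHolderFunction E F 1 r) : E → F)) : ℝ)
        ≤ (ε' * ‖v‖ + 16 / (ε' * h ^ 2) * A) + 2 * (ε' * ‖v‖ + 2 / ε' * A) := by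
      rw [hwcoe]
      have hL : ∀ x y, dist (iteratedFDeriv ℝ 1 (v : E → F) x) (iteratedFDeriv ℝ 1 (v : E → F) y) ≤
          (ε' * ‖v‖ + 16 / (ε' * h ^ 2) * A) * dist x y :=
        dist_le_mul_of_norm_fderiv_le
          (v.contDiff.differentiable_iteratedFDeriv (by norm_num)) fun z => by
            rw [norm_fderiv_iteratedFDeriv]; exact hD2 z
      have hM : ∀ x, ‖iteratedFDeriv ℝ 1 (v : E → F) x‖ ≤ ε' * ‖v‖ + 2 / ε' * A := fun x => by
        rw [← norm_iteratedFDeriv_fderiv (n := 0), norm_iteratedFDeriv_zero]; exact hD1 x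
      have hB0 : 0 ≤ ε' * ‖v‖ + 16 / (ε' * h ^ 2) * A := by positivity
      have hM0 : 0 ≤ ε' * ‖v‖ + 2 / ε' * A := by positivity
      have hH := holderWith_of_dist_le_mul_of_norm_le (B := ⟨_, hB0⟩) (M := ⟨_, hM0⟩) hr1 hL hM
      have := hH.nnholderNorm_le
      have := NNReal.coe_le_coe.2 this
      push_cast at this
      exact this
    have hwnorm : ‖w‖ = w.supNormDeriv 0 + w.supNormDeriv 1 +
        nnHolderNorm r (iteratedFDeriv ℝ 1 ((w : ContDiffHolderFunction E F 1 r) : E → F)) := by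
      rw [w.norm_def, Finset.sum_range_succ, Finset.sum_range_one]
    rw [hwnorm]
    have h4 : ε' * ‖v‖ * 4 = ε * ‖v‖ := by rw [hε']; ring
    have e1 := add_le_add (add_le_add hw0 hw1) hwH
    have e2 : A + (ε' * ‖v‖ + 2 / ε' * A) +
        ((ε' * ‖v‖ + 16 / (ε' * h ^ 2) * A) + 2 * (ε' * ‖v‖ + 2 / ε' * A)) =
        ε' * ‖v‖ * 4 + (1 + 3 * (2 / ε') + 16 / (ε' * h ^ 2)) * A := by ring
    have hCA : (1 + 3 * (2 / ε') + 16 / (ε' * h ^ 2)) * A ≤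
        (2 / ε' + 16 / (ε' * h ^ 2) + (1 + 3 * (2 / ε') + 16 / (ε' * h ^ 2))) * A :=
      mul_le_mul_of_nonneg_right (le_add_of_nonneg_left (by positivity)) hA0
    linarith

end Entries

end Literature.Analysis.FunctionSpaces

end
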